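import Summits.QuantumFields.YangMills.Theorems.FluctuationComparisonRegPrIntLBeyondOneLoopInteriorGasDoor
import HarnessLib

/-!
# THE INTERIOR MULTI-GAS DOOR FOR ROW 2 OF THE S2β TABLE: finitely many Kotecký–Preiss SPECIES `f¹ = c + F₀ + Σᵢ log Ξ(wᵢ)` with `Σᵢ Nᵢ ≤ Φ_J` GIVE ⟨REP∘⟩ and the
# REGISTERED interior row H4ᶜ∘ `BeyondOneLoopSmallIntCan` VERBATIM — KPL per species + ADDITIVITY of polymer representations (KP-activity letter №2)

Cell `ym3-torus` (YM ladder rung R3 = continuum `SU(2)` Yang–Mills on the three-torus — a RUNG, NOT d = 4, NOT infinite volume, NOT a mass gap, NOT Clay).  Seat `ymfull-r3-prover-2`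
(gen 0; R600-ym: hand = the REGISTERED stub `stub_beyondOneLoopSmallIntCan : BeyondOneLoopSmallIntCan`, registry `Cruxes/FluctuationComparisonRegPrIntL/Lines/semiclassical_s2beta.lean`
v11.4 `def` l.571 ∕ stub l.1580; PLAN `Lines/loop_ledger.lean` v6; lane per LEAD w3 g23 №4: «the KP-activity letters»); `--supports stmt-QuantumFields-20520 --as helper`, count-neutral,
definition-free, default heartbeats; no registry, binder or `Lines/` edit (RULING №36 untouched).  Fourth of a chain: ✓p786380 FILE 1 `…BeyondOneLoopInteriorDoor`, ✓p787654 FILE 2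
`…BeyondOneLoopInteriorGasDoor`, ✓p787786 KP letter №1 `…KPGasOfGeometricActivities`, FILE 4 `…BeyondOneLoopInteriorGeometricDoor`.

WHAT.  Print delivers the small-field effective action as a SUM OVER SPECIES — one localized expansion per renormalization step, `A_k = −g_k^{−2}A + Σ_j E^{(j)}`, each `E^{(j)}`
the LOGARITHM (Mayer step) of that step's exponentiated cluster expansion ([Balaban1987RG1] (0.23)–(0.26) p.257; in d = 3 [Balaban1985UV3] (41)–(46), the per-step sum
`Σ_j Σ_{Y_j} 𝒫_j`), plus boundary ∕ `𝐑′` species ([Balaban1989LargeFieldII] (1.98)–(1.100)).  The gas door GAS∘ of LINE g19-2 asks for ONE hard-core gas; a product of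
independent gases `Π_i Ξ(w_i)` is NOT a hard-core gas on the same polymer space, but its logarithm is a SUM of V-local polymer representations, and those ADD (LINE g19-2 §1
✓`polymerRepOn_add` ∕ `polymerRepOn_finset_sum`, Lines-side).  THIS FILE = the Theorems-side letter:
* §1 (generic bond type `B`, fields `B → G`, pseudo-distance `δ`, window `W`, rate `κ`; the `PolymerRepOn` package δ-unfolded): `polymerSum_const`, `polymerSum_congr`,
  `polymerSum_add` (concatenation `Fin.append`, norms add — LINE g19-2 v1 §1's proof lifted, credit ideator ym-r3-idea-1 g19), `polymerSum_finset_sum` (finite species).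
* §2 ★ `repInt_of_multiGasInt : ⟨MGAS∘⟩ → ⟨REP∘⟩` — ⟨MGAS∘⟩ = GAS∘ with, per depth, `∃ m c (N : Fin m → ℝ) (w : Fin m → activities)`, each `w i` a `KPGasOn window κ (N i)` (text of
  `Lines/loop_ledger.lean` v6 §1c δ-unfolded), `Σ_i N i ≤ Φ J`, and the identity `f¹ = c + F₀ + Σ_i log Ξ(w_i)` on the interior window; proof: KPL BY NAME per species
  (✓`…S2BetaKPLogRep.kpLogRep'`) then `polymerSum_finset_sum`; ★★ `beyondOneLoopSmallInt_of_multiGasInt : ⟨SCL∘⟩ → ⟨MGAS∘⟩ → ⟨BeyondOneLoopSmallIntCan VERBATIM⟩` (FILE 1's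
  ✓`beyondOneLoopSmallInt_of_repInt` after it).  A GEOMETRIC species (connected support, `E_i q^{|X|}`) enters through KP letter №1 ✓`kpGasOn_of_geometric` with `N i := E_i`.
Door-fit (HOME cert): `example (hS : SemiclassicalLimitCan) (hM : ⟨MGAS∘⟩) : BeyondOneLoopSmallIntCan` against the pasted registry v11.4 ∕ loop_ledger v6 texts; `m := 1` recovers GAS∘.

HONEST SCOPE.  Finite-sum bookkeeping + quantifier plumbing; ⟨MGAS∘⟩ ∕ ⟨SCL∘⟩ are HYPOTHESES (⟨MGAS∘⟩ IS the XL multi-step small-field expansion in identity form); nothing of Bałaban's is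
asserted or proved; `BeyondOneLoopSmallIntCan`, the other four registered ∘-stubs, S2β and `FluctuationComparisonRegPrIntL` (stmt-QuantumFields-20520) are NOT proved; no summit statement
is proved by a helper; rung R3 = SU(2) YM₃ on T³ — finite volume, conditional; NOT d = 4, NOT infinite volume, NOT a mass gap, NOT Clay; the Yang–Mills mass gap is NOT proved.

References: T. Bałaban, CMP **109** (1987) 249–301 [Balaban1987RG1] ((0.22)–(0.26) pp.256–257); CMP **102** (1985) 255–275 [Balaban1985UV3] ((41)–(47) pp.266–267); CMP **122** (1989)
355–392 [Balaban1989LargeFieldII] ((1.97)–(1.100) pp.389–390); R. Kotecký, D. Preiss, CMP **103** (1986) 491–498 [KoteckyPreiss1986] (Theorem p.492 (2),(4)).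
-/

noncomputable section

open MeasureTheory Filter Topology Set
open scoped BigOperators
open Literature.Probability.LatticeModels (polymerPartitionFunction polyInc)
open Literature.MathematicalPhysics.QuantumFieldTheory.Balaban1983to89
open Literature.MathematicalPhysics.QuantumFieldTheory.Balaban1983to89.T3ContinuumYM3Torus
open Literature.MathematicalPhysics.QuantumFieldTheory.Balaban1983to89.T3NestedUnitLaws
open Literature.MathematicalPhysics.QuantumFieldTheory.Balaban1983to89.T3UnitLawDensityEML
open Literature.MathematicalPhysics.QuantumFieldTheory.Balaban1983to89.T3UnitScaleTilt
open Literature.MathematicalPhysics.QuantumFieldTheory.Balaban1983to89.T3TiltDescent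
open Literature.MathematicalPhysics.QuantumFieldTheory.Balaban1983to89.T3PrintedRegularMinimiser
open Summit.QuantumFields.YangMills.Theorems.BeyondOneLoopInteriorDoor

namespace Summit.QuantumFields.YangMills.Theorems.BeyondOneLoopInteriorMultiGasDoor

/-! ## §1 Generic: the algebra of V-local polymer representations (δ-unfolded `PolymerRepOn`): constants, congruence, sums -/

section Algebra

variable {B G : Type*} [DecidableEq B] (δ : B → B → ℝ) (W : Set (B → G)) (κ : ℝ)

open Classical in
/-- **NORM ZERO**: a function constant on `W` has the empty representation, of norm `≤ N` for any `N ≥ 0`. [cite: Balaban1987RG1, (0.23)-(0.26) pp.256-257] -/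
theorem polymerSum_const {N : ℝ} (hN : 0 ≤ N) (f : (B → G) → ℝ) (c : ℝ) (hf : ∀ U, U ∈ W → f U = c) :
    ∃ (n : ℕ) (supp : Fin n → Finset B) (len wt : Fin n → ℝ) (act : Fin n → (B → G) → ℝ) (c : ℝ),
      (∀ i (U U' : B → G), (∀ e ∈ supp i, U e = U' e) → act i U = act i U') ∧ (∀ i, 0 ≤ wt i) ∧
      (∀ i, ∀ e ∈ supp i, ∀ e' ∈ supp i, δ e e' ≤ len i) ∧
      (∀ i U, U ∈ W → |act i U| ≤ wt i) ∧
      (∀ e : B, ∑ i ∈ Finset.univ.filter (fun i => e ∈ supp i), wt i * Real.exp (κ * len i) ≤ N) ∧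
      ∀ U, U ∈ W → f U = c + ∑ i, act i U := by
  refine ⟨0, Fin.elim0, Fin.elim0, Fin.elim0, Fin.elim0, c, fun i => i.elim0, fun i => i.elim0, fun i => i.elim0, fun i => i.elim0, fun e => ?_, fun U hU => ?_⟩
  · rw [Finset.sum_eq_zero fun i _ => i.elim0]; exact hN
  · simp [hf U hU]

open Classical in
/-- **CONGRUENCE ON THE WINDOW**: a representation only reads its function on `W`. [cite: Balaban1987RG1, (0.23)-(0.26) pp.256-257] -/
theorem polymerSum_congr {N : ℝ} {f g : (B → G) → ℝ} (hfg : ∀ U, U ∈ W → g U = f U)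
    (h : ∃ (n : ℕ) (supp : Fin n → Finset B) (len wt : Fin n → ℝ) (act : Fin n → (B → G) → ℝ) (c : ℝ),
      (∀ i (U U' : B → G), (∀ e ∈ supp i, U e = U' e) → act i U = act i U') ∧ (∀ i, 0 ≤ wt i) ∧
      (∀ i, ∀ e ∈ supp i, ∀ e' ∈ supp i, δ e e' ≤ len i) ∧
      (∀ i U, U ∈ W → |act i U| ≤ wt i) ∧
      (∀ e : B, ∑ i ∈ Finset.univ.filter (fun i => e ∈ supp i), wt i * Real.exp (κ * len i) ≤ N) ∧
      ∀ U, U ∈ W → f U = c + ∑ i, act i U) :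
    ∃ (n : ℕ) (supp : Fin n → Finset B) (len wt : Fin n → ℝ) (act : Fin n → (B → G) → ℝ) (c : ℝ),
      (∀ i (U U' : B → G), (∀ e ∈ supp i, U e = U' e) → act i U = act i U') ∧ (∀ i, 0 ≤ wt i) ∧
      (∀ i, ∀ e ∈ supp i, ∀ e' ∈ supp i, δ e e' ≤ len i) ∧
      (∀ i U, U ∈ W → |act i U| ≤ wt i) ∧
      (∀ e : B, ∑ i ∈ Finset.univ.filter (fun i => e ∈ supp i), wt i * Real.exp (κ * len i) ≤ N) ∧
      ∀ U, U ∈ W → g U = c + ∑ i, act i U := by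
  obtain ⟨n, supp, len, wt, act, c, hloc, hwt, hdiam, hbd, hcov, hrep⟩ := h
  exact ⟨n, supp, len, wt, act, c, hloc, hwt, hdiam, hbd, hcov, fun U hU => (hfg U hU).trans (hrep U hU)⟩

open Classical in
/-- **ADDITIVITY**: representations of `f` (norm `≤ N₁`) and `g` (norm `≤ N₂`) on the same window at the same rate CONCATENATE (`Fin.append`) to one of `f + g` of norm
`≤ N₁ + N₂` — print's «`Σ_j Σ_{X ∈ D_j} E^{(j)}(X)`» read as ONE localized expansion (LINE g19-2 §1 `polymerRepOn_add`, proof lifted). [cite: Balaban1987RG1, (0.23)-(0.26) pp.256-257] -/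
theorem polymerSum_add {N₁ N₂ : ℝ} {f g : (B → G) → ℝ}
    (hf : ∃ (n : ℕ) (supp : Fin n → Finset B) (len wt : Fin n → ℝ) (act : Fin n → (B → G) → ℝ) (c : ℝ),
      (∀ i (U U' : B → G), (∀ e ∈ supp i, U e = U' e) → act i U = act i U') ∧ (∀ i, 0 ≤ wt i) ∧
      (∀ i, ∀ e ∈ supp i, ∀ e' ∈ supp i, δ e e' ≤ len i) ∧
      (∀ i U, U ∈ W → |act i U| ≤ wt i) ∧
      (∀ e : B, ∑ i ∈ Finset.univ.filter (fun i => e ∈ supp i), wt i * Real.exp (κ * len i) ≤ N₁) ∧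
      ∀ U, U ∈ W → f U = c + ∑ i, act i U)
    (hg : ∃ (n : ℕ) (supp : Fin n → Finset B) (len wt : Fin n → ℝ) (act : Fin n → (B → G) → ℝ) (c : ℝ),
      (∀ i (U U' : B → G), (∀ e ∈ supp i, U e = U' e) → act i U = act i U') ∧ (∀ i, 0 ≤ wt i) ∧
      (∀ i, ∀ e ∈ supp i, ∀ e' ∈ supp i, δ e e' ≤ len i) ∧
      (∀ i U, U ∈ W → |act i U| ≤ wt i) ∧
      (∀ e : B, ∑ i ∈ Finset.univ.filter (fun i => e ∈ supp i), wt i * Real.exp (κ * len i) ≤ N₂) ∧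
      ∀ U, U ∈ W → g U = c + ∑ i, act i U) :
    ∃ (n : ℕ) (supp : Fin n → Finset B) (len wt : Fin n → ℝ) (act : Fin n → (B → G) → ℝ) (c : ℝ),
      (∀ i (U U' : B → G), (∀ e ∈ supp i, U e = U' e) → act i U = act i U') ∧ (∀ i, 0 ≤ wt i) ∧
      (∀ i, ∀ e ∈ supp i, ∀ e' ∈ supp i, δ e e' ≤ len i) ∧
      (∀ i U, U ∈ W → |act i U| ≤ wt i) ∧
      (∀ e : B, ∑ i ∈ Finset.univ.filter (fun i => e ∈ supp i), wt i * Real.exp (κ * len i) ≤ N₁ + N₂) ∧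
      ∀ U, U ∈ W → (fun U => f U + g U) U = c + ∑ i, act i U := by
  obtain ⟨n₁, supp₁, len₁, wt₁, act₁, c₁, hloc₁, hwt₁, hdiam₁, hbd₁, hcov₁, hrep₁⟩ := hf
  obtain ⟨n₂, supp₂, len₂, wt₂, act₂, c₂, hloc₂, hwt₂, hdiam₂, hbd₂, hcov₂, hrep₂⟩ := hg
  refine ⟨n₁ + n₂, Fin.append supp₁ supp₂, Fin.append len₁ len₂, Fin.append wt₁ wt₂, Fin.append act₁ act₂, c₁ + c₂,
    ?_, ?_, ?_, ?_, ?_, ?_⟩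
  · intro X U U' hUU'
    cases X using Fin.addCases with
    | left i => rw [Fin.append_left] at hUU' ⊢; exact hloc₁ i U U' hUU'
    | right i => rw [Fin.append_right] at hUU' ⊢; exact hloc₂ i U U' hUU'
  · intro X
    cases X using Fin.addCases with
    | left i => rw [Fin.append_left]; exact hwt₁ i
    | right i => rw [Fin.append_right]; exact hwt₂ i
  · intro X
    cases X using Fin.addCases with
    | left i => rw [Fin.append_left, Fin.append_left]; exact hdiam₁ i
    | right i => rw [Fin.append_right, Fin.append_right]; exact hdiam₂ i
  · intro X U hU
    cases X using Fin.addCases with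
    | left i => rw [Fin.append_left, Fin.append_left]; exact hbd₁ i U hU
    | right i => rw [Fin.append_right, Fin.append_right]; exact hbd₂ i U hU
  · intro e
    rw [Finset.sum_filter, Fin.sum_univ_add]
    simp only [Fin.append_left, Fin.append_right]
    rw [← Finset.sum_filter, ← Finset.sum_filter]
    exact add_le_add (hcov₁ e) (hcov₂ e)
  · intro U hU
    rw [Fin.sum_univ_add]
    simp only [Fin.append_left, Fin.append_right]
    rw [hrep₁ U hU, hrep₂ U hU]; ring

open Classical in
/-- **FINITE SPECIES**: representations of `R i` of norms `≤ a i`, `i ∈ s`, sum to ONE representation of `Σ_{i∈s} R i` of norm `≤ Σ_{i∈s} a i` (LINE g19-2 §1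
`polymerRepOn_finset_sum`, proof lifted). [cite: Balaban1987RG1, (0.23)-(0.26) pp.256-257] -/
theorem polymerSum_finset_sum {ι : Type*} (s : Finset ι) {a : ι → ℝ} {R : ι → (B → G) → ℝ}
    (h : ∀ i ∈ s, ∃ (n : ℕ) (supp : Fin n → Finset B) (len wt : Fin n → ℝ) (act : Fin n → (B → G) → ℝ) (c : ℝ),
      (∀ i (U U' : B → G), (∀ e ∈ supp i, U e = U' e) → act i U = act i U') ∧ (∀ i, 0 ≤ wt i) ∧
      (∀ i, ∀ e ∈ supp i, ∀ e' ∈ supp i, δ e e' ≤ len i) ∧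
      (∀ i U, U ∈ W → |act i U| ≤ wt i) ∧
      (∀ e : B, ∑ i ∈ Finset.univ.filter (fun i => e ∈ supp i), wt i * Real.exp (κ * len i) ≤ a i) ∧
      ∀ U, U ∈ W → (R i) U = c + ∑ i, act i U) :
    ∃ (n : ℕ) (supp : Fin n → Finset B) (len wt : Fin n → ℝ) (act : Fin n → (B → G) → ℝ) (c : ℝ),
      (∀ i (U U' : B → G), (∀ e ∈ supp i, U e = U' e) → act i U = act i U') ∧ (∀ i, 0 ≤ wt i) ∧
      (∀ i, ∀ e ∈ supp i, ∀ e' ∈ supp i, δ e e' ≤ len i) ∧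
      (∀ i U, U ∈ W → |act i U| ≤ wt i) ∧
      (∀ e : B, ∑ i ∈ Finset.univ.filter (fun i => e ∈ supp i), wt i * Real.exp (κ * len i) ≤ ∑ i ∈ s, a i) ∧
      ∀ U, U ∈ W → (fun U => ∑ i ∈ s, R i U) U = c + ∑ i, act i U := by
  induction s using Finset.induction_on with
  | empty =>
    simpa using polymerSum_const δ W κ (N := 0) le_rfl (fun _ => (0 : ℝ)) 0 (fun _ _ => rfl)
  | insert i s hi ih =>
    have h₁ := h i (Finset.mem_insert_self i s)
    have h₂ := ih (fun j hj => h j (Finset.mem_insert_of_mem hj))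
    rw [Finset.sum_insert hi]
    exact polymerSum_congr δ W κ (fun U _ => Finset.sum_insert hi) (polymerSum_add δ W κ h₁ h₂)

end Algebra

/-! ## §2 The doors: ⟨MGAS∘⟩ → ⟨REP∘⟩ (KPL per species, then additivity) and ⟨SCL∘⟩ → ⟨MGAS∘⟩ → H4ᶜ∘ VERBATIM -/

section Doors

open Classical in
/-- ★ **⟨MGAS∘⟩ → ⟨REP∘⟩: FINITELY MANY KOTECKÝ–PREISS SPECIES GIVE ONE V-LOCAL POLYMER REPRESENTATION.**  Per depth: each species `w i` is represented on the interior window by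
KPL (✓`…S2BetaKPLogRep.kpLogRep'`, norm `N i`); the species add (`polymerSum_finset_sum`, norm `Σ_i N i ≤ Φ J`); `R := Σ_i log Ξ(w_i)`.
[cite: Balaban1987RG1, (0.22)-(0.26) pp.256-257; KoteckyPreiss1986, Theorem p.492 (2),(4)] -/
theorem repInt_of_multiGasInt
    (hM : ∀ (L : ℕ), ∃ c₀ : ℝ, 0 < c₀ ∧ c₀ ≤ 1 ∧ ∀ (cw : ℝ), 0 < cw → cw ≤ c₀ →
      ∃ pS : ℝ, ∀ (b₀ p₀ : ℝ), 0 < b₀ → pS ≤ p₀ → 0 < p₀ → ∃ ε₁ : ℝ, 0 < ε₁ ∧ ∀ (ε₀ : ℝ), 0 < ε₀ → ε₀ ≤ ε₁ →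
      ∃ γ₁ : ℝ, 0 < γ₁ ∧ ∃ κ : ℝ, 0 < κ ∧
        ∀ (F : T3Family) (γ : ℝ), F.L = L → 0 < γ → γ ≤ γ₁ →
          ∃ Φ : ℕ → ℝ, (∀ J, 0 ≤ Φ J) ∧ Tendsto (fun J : ℕ => (J : ℝ) * Φ J) atTop (𝓝 0) ∧
            ∀ (J K : ℕ) (hJK : J ≤ K),
              ∃ (m : ℕ) (c : ℝ) (N : Fin m → ℝ) (w : Fin m → GaugeField (F.P J) 0 (Matrix.specialUnitaryGroup (Fin 2) ℂ) → Finset (PBond (F.P J) 0) → ℝ),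
                (∀ i : Fin m, (∃ (wbar a ℓ : Finset (PBond (F.P J) 0) → ℝ),
                  (∀ U, (w i) U ∅ = 0) ∧
                  (∀ (X : Finset (PBond (F.P J) 0)) (U U' : GaugeField (F.P J) 0 (Matrix.specialUnitaryGroup (Fin 2) ℂ)), (∀ e ∈ X, U e = U' e) → (w i) U X = (w i) U' X) ∧
                  (∀ X, 0 ≤ a X) ∧ (∀ X, 0 ≤ ℓ X) ∧
                  (∀ U, U ∈ {U : GaugeField (F.P J) 0 (Matrix.specialUnitaryGroup (Fin 2) ℂ) | PlaqSmall (θBal F.L γ (cw * b₀) p₀ J) U} → ∀ X, |(w i) U X| ≤ wbar X) ∧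
                  (∀ X : Finset (PBond (F.P J) 0), ∀ e ∈ X, ∀ e' ∈ X, (e.src.tdist e'.src : ℝ) ≤ ℓ X) ∧
                  (∀ X : Finset (PBond (F.P J) 0), ∑ X' ∈ Finset.univ.filter (fun X' => polyInc X' X), wbar X' * Real.exp (a X' + κ * ℓ X') ≤ a X) ∧
                  (∀ e : PBond (F.P J) 0, a {e} ≤ N i))) ∧
                (∑ i, N i ≤ Φ J) ∧
                ∀ U : GaugeField (F.P J) 0 (Matrix.specialUnitaryGroup (Fin 2) ℂ), PlaqSmall (θBal F.L γ (cw * b₀) p₀ J) U →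
                  (Real.log (Node00.canonVersion (fieldMeasure (F.P J) 0 (Matrix.specialUnitaryGroup (Fin 2) ℂ)) (heightDensity F (γ / 1) hJK (histGood F ℰp (θBal F.L γ b₀ p₀) K J)) U) + (F.scheme ℰp (γ / 1)).β K * minActionRegPr F J K hJK ε₀ U)
                    = c + limUnder atTop (fun lam : ℝ => (Real.log (Node00.canonVersion (fieldMeasure (F.P J) 0 (Matrix.specialUnitaryGroup (Fin 2) ℂ)) (heightDensity F (γ / lam) hJK (histGood F ℰp (θBal F.L γ b₀ p₀) K J)) U) + (F.scheme ℰp (γ / lam)).β K * minActionRegPr F J K hJK ε₀ U)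
                        - (Real.log (Node00.canonVersion (fieldMeasure (F.P J) 0 (Matrix.specialUnitaryGroup (Fin 2) ℂ)) (heightDensity F (γ / lam) hJK (histGood F ℰp (θBal F.L γ b₀ p₀) K J)) 1) + (F.scheme ℰp (γ / lam)).β K * minActionRegPr F J K hJK ε₀ 1))
                      + ∑ i, Real.log (polymerPartitionFunction polyInc (fun X : Finset (PBond (F.P J) 0) => (((w i) U X : ℝ) : ℂ)) Finset.univ).re) :
    ∀ (L : ℕ), ∃ c₀ : ℝ, 0 < c₀ ∧ c₀ ≤ 1 ∧ ∀ (cw : ℝ), 0 < cw → cw ≤ c₀ →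
      ∃ pS : ℝ, ∀ (b₀ p₀ : ℝ), 0 < b₀ → pS ≤ p₀ → 0 < p₀ → ∃ ε₁ : ℝ, 0 < ε₁ ∧ ∀ (ε₀ : ℝ), 0 < ε₀ → ε₀ ≤ ε₁ →
      ∃ γ₁ : ℝ, 0 < γ₁ ∧ ∃ κ : ℝ, 0 < κ ∧
        ∀ (F : T3Family) (γ : ℝ), F.L = L → 0 < γ → γ ≤ γ₁ →
          ∃ Φ : ℕ → ℝ, (∀ J, 0 ≤ Φ J) ∧ Tendsto (fun J : ℕ => (J : ℝ) * Φ J) atTop (𝓝 0) ∧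
            ∀ (J K : ℕ) (hJK : J ≤ K),
              ∃ (c : ℝ) (R : GaugeField (F.P J) 0 (Matrix.specialUnitaryGroup (Fin 2) ℂ) → ℝ) (a : ℝ),
                (∀ U : GaugeField (F.P J) 0 (Matrix.specialUnitaryGroup (Fin 2) ℂ), PlaqSmall (θBal F.L γ (cw * b₀) p₀ J) U →
                  (Real.log (Node00.canonVersion (fieldMeasure (F.P J) 0 (Matrix.specialUnitaryGroup (Fin 2) ℂ)) (heightDensity F (γ / 1) hJK (histGood F ℰp (θBal F.L γ b₀ p₀) K J)) U) + (F.scheme ℰp (γ / 1)).β K * minActionRegPr F J K hJK ε₀ U)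
                      = c + limUnder atTop (fun lam : ℝ => (Real.log (Node00.canonVersion (fieldMeasure (F.P J) 0 (Matrix.specialUnitaryGroup (Fin 2) ℂ)) (heightDensity F (γ / lam) hJK (histGood F ℰp (θBal F.L γ b₀ p₀) K J)) U) + (F.scheme ℰp (γ / lam)).β K * minActionRegPr F J K hJK ε₀ U)
                          - (Real.log (Node00.canonVersion (fieldMeasure (F.P J) 0 (Matrix.specialUnitaryGroup (Fin 2) ℂ)) (heightDensity F (γ / lam) hJK (histGood F ℰp (θBal F.L γ b₀ p₀) K J)) 1) + (F.scheme ℰp (γ / lam)).β K * minActionRegPr F J K hJK ε₀ 1)) + R U) ∧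
                (∃ (n : ℕ) (supp : Fin n → Finset (PBond (F.P J) 0)) (len wt : Fin n → ℝ) (act : Fin n → GaugeField (F.P J) 0 (Matrix.specialUnitaryGroup (Fin 2) ℂ) → ℝ) (c' : ℝ),
                  (∀ X (U U' : GaugeField (F.P J) 0 (Matrix.specialUnitaryGroup (Fin 2) ℂ)), (∀ e ∈ supp X, U e = U' e) → act X U = act X U') ∧
                  (∀ X, 0 ≤ wt X) ∧
                  (∀ X, ∀ e ∈ supp X, ∀ e' ∈ supp X, (e.src.tdist e'.src : ℝ) ≤ len X) ∧
                  (∀ X U, U ∈ {U : GaugeField (F.P J) 0 (Matrix.specialUnitaryGroup (Fin 2) ℂ) | PlaqSmall (θBal F.L γ (cw * b₀) p₀ J) U} → |act X U| ≤ wt X) ∧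
                  (∀ e : PBond (F.P J) 0, ∑ X ∈ Finset.univ.filter (fun X => e ∈ supp X), wt X * Real.exp (κ * len X) ≤ a) ∧
                  ∀ U, U ∈ {U : GaugeField (F.P J) 0 (Matrix.specialUnitaryGroup (Fin 2) ℂ) | PlaqSmall (θBal F.L γ (cw * b₀) p₀ J) U} →
                    R U = c' + ∑ X, act X U) ∧
                a ≤ Φ J := by
  intro L
  obtain ⟨c₀, hc₀, hc₀1, H⟩ := hM L
  refine ⟨c₀, hc₀, hc₀1, fun cw hcw hcwle => ?_⟩
  obtain ⟨pS, H0⟩ := H cw hcw hcwle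
  refine ⟨pS, fun b₀ p₀ hb hp hp0 => ?_⟩
  obtain ⟨ε₁, hε₁, H1⟩ := H0 b₀ p₀ hb hp hp0
  refine ⟨ε₁, hε₁, fun ε₀ hε₀ hε₀le => ?_⟩
  obtain ⟨γ₁, hγ₁, κ, hκ, H2⟩ := H1 ε₀ hε₀ hε₀le
  refine ⟨γ₁, hγ₁, κ, hκ, fun F γ hFL hγ hγle => ?_⟩
  obtain ⟨Φ, hΦ0, hΦ, H3⟩ := H2 F γ hFL hγ hγle
  refine ⟨Φ, hΦ0, hΦ, fun J K hJK => ?_⟩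
  obtain ⟨m, c, N, w, hgas, hN, hid⟩ := H3 J K hJK
  -- the species, represented on the interior window by KPL, add up (`polymerSum_finset_sum`)
  have hsum := polymerSum_finset_sum (fun e e' : PBond (F.P J) 0 => (e.src.tdist e'.src : ℝ))
    {U : GaugeField (F.P J) 0 (Matrix.specialUnitaryGroup (Fin 2) ℂ) | PlaqSmall (θBal F.L γ (cw * b₀) p₀ J) U} κ (Finset.univ : Finset (Fin m)) (a := N)
    (R := fun i (U : GaugeField (F.P J) 0 (Matrix.specialUnitaryGroup (Fin 2) ℂ)) => Real.log ((polymerPartitionFunction polyInc (fun X : Finset (PBond (F.P J) 0) => (((w i) U X : ℝ) : ℂ)) Finset.univ).re))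
    (fun i _ => Summit.QuantumFields.YangMills.Theorems.FluctuationComparisonRegPrIntLS2BetaKPLogRep.kpLogRep'
      {U : GaugeField (F.P J) 0 (Matrix.specialUnitaryGroup (Fin 2) ℂ) | PlaqSmall (θBal F.L γ (cw * b₀) p₀ J) U} κ (N i) hκ.le (w i) (hgas i))
  refine ⟨c, fun U => ∑ i, Real.log ((polymerPartitionFunction polyInc (fun X : Finset (PBond (F.P J) 0) => (((w i) U X : ℝ) : ℂ)) Finset.univ).re), ∑ i, N i,
    fun U hU => hid U hU, hsum, hN⟩

open Classical in
/-- ★★ **⟨SCL∘⟩ → ⟨MGAS∘⟩ → H4ᶜ∘ `BeyondOneLoopSmallIntCan` VERBATIM** — FILE 1's ✓`beyondOneLoopSmallInt_of_repInt` after `repInt_of_multiGasInt`.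
[cite: Balaban1985UV3, (45)-(47) p.267; Balaban1987RG1, Thm 1 (0.19)-(0.26) pp.255-257] -/
theorem beyondOneLoopSmallInt_of_multiGasInt
    (hS : ∀ (L : ℕ), ∃ c₀ : ℝ, 0 < c₀ ∧ c₀ ≤ 1 ∧ ∀ (cw : ℝ), 0 < cw → cw ≤ c₀ →
      ∃ pS : ℝ, ∀ (b₀ p₀ : ℝ), 0 < b₀ → pS ≤ p₀ → 0 < p₀ → ∃ ε₁ : ℝ, 0 < ε₁ ∧ ∀ (ε₀ : ℝ), 0 < ε₀ → ε₀ ≤ ε₁ →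
      ∃ γ₁ : ℝ, 0 < γ₁ ∧ ∀ (F : T3Family) (γ : ℝ), F.L = L → 0 < γ → γ ≤ γ₁ →
        ∀ (J K : ℕ) (hJK : J ≤ K) (V : GaugeField (F.P J) 0 (Matrix.specialUnitaryGroup (Fin 2) ℂ)), PlaqSmall (θBal F.L γ (cw * b₀) p₀ J) V →
          ∃ a : ℝ, Tendsto (fun lam : ℝ =>
            (Real.log (Node00.canonVersion (fieldMeasure (F.P J) 0 (Matrix.specialUnitaryGroup (Fin 2) ℂ)) (heightDensity F (γ / lam) hJK (histGood F ℰp (θBal F.L γ b₀ p₀) K J)) V) + (F.scheme ℰp (γ / lam)).β K * minActionRegPr F J K hJK ε₀ V)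
            - (Real.log (Node00.canonVersion (fieldMeasure (F.P J) 0 (Matrix.specialUnitaryGroup (Fin 2) ℂ)) (heightDensity F (γ / lam) hJK (histGood F ℰp (θBal F.L γ b₀ p₀) K J)) 1) + (F.scheme ℰp (γ / lam)).β K * minActionRegPr F J K hJK ε₀ 1)) atTop (𝓝 a))
    (hM : ∀ (L : ℕ), ∃ c₀ : ℝ, 0 < c₀ ∧ c₀ ≤ 1 ∧ ∀ (cw : ℝ), 0 < cw → cw ≤ c₀ →
      ∃ pS : ℝ, ∀ (b₀ p₀ : ℝ), 0 < b₀ → pS ≤ p₀ → 0 < p₀ → ∃ ε₁ : ℝ, 0 < ε₁ ∧ ∀ (ε₀ : ℝ), 0 < ε₀ → ε₀ ≤ ε₁ →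
      ∃ γ₁ : ℝ, 0 < γ₁ ∧ ∃ κ : ℝ, 0 < κ ∧
        ∀ (F : T3Family) (γ : ℝ), F.L = L → 0 < γ → γ ≤ γ₁ →
          ∃ Φ : ℕ → ℝ, (∀ J, 0 ≤ Φ J) ∧ Tendsto (fun J : ℕ => (J : ℝ) * Φ J) atTop (𝓝 0) ∧
            ∀ (J K : ℕ) (hJK : J ≤ K),
              ∃ (m : ℕ) (c : ℝ) (N : Fin m → ℝ) (w : Fin m → GaugeField (F.P J) 0 (Matrix.specialUnitaryGroup (Fin 2) ℂ) → Finset (PBond (F.P J) 0) → ℝ),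
                (∀ i : Fin m, (∃ (wbar a ℓ : Finset (PBond (F.P J) 0) → ℝ),
                  (∀ U, (w i) U ∅ = 0) ∧
                  (∀ (X : Finset (PBond (F.P J) 0)) (U U' : GaugeField (F.P J) 0 (Matrix.specialUnitaryGroup (Fin 2) ℂ)), (∀ e ∈ X, U e = U' e) → (w i) U X = (w i) U' X) ∧
                  (∀ X, 0 ≤ a X) ∧ (∀ X, 0 ≤ ℓ X) ∧
                  (∀ U, U ∈ {U : GaugeField (F.P J) 0 (Matrix.specialUnitaryGroup (Fin 2) ℂ) | PlaqSmall (θBal F.L γ (cw * b₀) p₀ J) U} → ∀ X, |(w i) U X| ≤ wbar X) ∧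
                  (∀ X : Finset (PBond (F.P J) 0), ∀ e ∈ X, ∀ e' ∈ X, (e.src.tdist e'.src : ℝ) ≤ ℓ X) ∧
                  (∀ X : Finset (PBond (F.P J) 0), ∑ X' ∈ Finset.univ.filter (fun X' => polyInc X' X), wbar X' * Real.exp (a X' + κ * ℓ X') ≤ a X) ∧
                  (∀ e : PBond (F.P J) 0, a {e} ≤ N i))) ∧
                (∑ i, N i ≤ Φ J) ∧
                ∀ U : GaugeField (F.P J) 0 (Matrix.specialUnitaryGroup (Fin 2) ℂ), PlaqSmall (θBal F.L γ (cw * b₀) p₀ J) U →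
                  (Real.log (Node00.canonVersion (fieldMeasure (F.P J) 0 (Matrix.specialUnitaryGroup (Fin 2) ℂ)) (heightDensity F (γ / 1) hJK (histGood F ℰp (θBal F.L γ b₀ p₀) K J)) U) + (F.scheme ℰp (γ / 1)).β K * minActionRegPr F J K hJK ε₀ U)
                    = c + limUnder atTop (fun lam : ℝ => (Real.log (Node00.canonVersion (fieldMeasure (F.P J) 0 (Matrix.specialUnitaryGroup (Fin 2) ℂ)) (heightDensity F (γ / lam) hJK (histGood F ℰp (θBal F.L γ b₀ p₀) K J)) U) + (F.scheme ℰp (γ / lam)).β K * minActionRegPr F J K hJK ε₀ U)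
                        - (Real.log (Node00.canonVersion (fieldMeasure (F.P J) 0 (Matrix.specialUnitaryGroup (Fin 2) ℂ)) (heightDensity F (γ / lam) hJK (histGood F ℰp (θBal F.L γ b₀ p₀) K J)) 1) + (F.scheme ℰp (γ / lam)).β K * minActionRegPr F J K hJK ε₀ 1))
                      + ∑ i, Real.log (polymerPartitionFunction polyInc (fun X : Finset (PBond (F.P J) 0) => (((w i) U X : ℝ) : ℂ)) Finset.univ).re) :
    ∀ (L : ℕ), ∃ c₀ : ℝ, 0 < c₀ ∧ c₀ ≤ 1 ∧ ∀ (c : ℝ), 0 < c → c ≤ c₀ → ∃ pS : ℝ, ∀ (b₀ p₀ : ℝ), 0 < b₀ → pS ≤ p₀ → 0 < p₀ →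
      ∃ ε₁ : ℝ, 0 < ε₁ ∧ ∀ (ε₀ : ℝ), 0 < ε₀ → ε₀ ≤ ε₁ →
      ∃ γ₁ : ℝ, 0 < γ₁ ∧ ∃ κ : ℝ, 0 < κ ∧ ∀ (F : T3Family) (γ : ℝ), F.L = L → 0 < γ → γ ≤ γ₁ →
        ∃ φ₂ : ℕ → ℝ, (∀ J, 0 ≤ φ₂ J) ∧ Tendsto (fun J : ℕ => (J : ℝ) * φ₂ J) atTop (𝓝 0) ∧
          ∀ (J K : ℕ) (hJK : J ≤ K) (b b' : PBond (F.P J) 0) (U V W Z : GaugeField (F.P J) 0 (Matrix.specialUnitaryGroup (Fin 2) ℂ)),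
            PlaqSmall (θBal F.L γ (c * b₀) p₀ J) U → PlaqSmall (θBal F.L γ (c * b₀) p₀ J) V →
            PlaqSmall (θBal F.L γ (c * b₀) p₀ J) W → PlaqSmall (θBal F.L γ (c * b₀) p₀ J) Z →
            (∀ e, e ≠ b → U e = V e) → (∀ e, e ≠ b' → U e = W e) → (∀ e, e ≠ b' → V e = Z e) → (∀ e, e ≠ b → W e = Z e) →
            |(((Real.log (Node00.canonVersion (fieldMeasure (F.P J) 0 (Matrix.specialUnitaryGroup (Fin 2) ℂ)) (heightDensity F (γ / 1) hJK (histGood F ℰp (θBal F.L γ b₀ p₀) K J)) U) + (F.scheme ℰp (γ / 1)).β K * minActionRegPr F J K hJK ε₀ U)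
                - (Real.log (Node00.canonVersion (fieldMeasure (F.P J) 0 (Matrix.specialUnitaryGroup (Fin 2) ℂ)) (heightDensity F (γ / 1) hJK (histGood F ℰp (θBal F.L γ b₀ p₀) K J)) V) + (F.scheme ℰp (γ / 1)).β K * minActionRegPr F J K hJK ε₀ V))
              - ((Real.log (Node00.canonVersion (fieldMeasure (F.P J) 0 (Matrix.specialUnitaryGroup (Fin 2) ℂ)) (heightDensity F (γ / 1) hJK (histGood F ℰp (θBal F.L γ b₀ p₀) K J)) W) + (F.scheme ℰp (γ / 1)).β K * minActionRegPr F J K hJK ε₀ W)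
                - (Real.log (Node00.canonVersion (fieldMeasure (F.P J) 0 (Matrix.specialUnitaryGroup (Fin 2) ℂ)) (heightDensity F (γ / 1) hJK (histGood F ℰp (θBal F.L γ b₀ p₀) K J)) Z) + (F.scheme ℰp (γ / 1)).β K * minActionRegPr F J K hJK ε₀ Z)))
              - limUnder atTop (fun lam : ℝ =>
                ((Real.log (Node00.canonVersion (fieldMeasure (F.P J) 0 (Matrix.specialUnitaryGroup (Fin 2) ℂ)) (heightDensity F (γ / lam) hJK (histGood F ℰp (θBal F.L γ b₀ p₀) K J)) U) + (F.scheme ℰp (γ / lam)).β K * minActionRegPr F J K hJK ε₀ U)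
                  - (Real.log (Node00.canonVersion (fieldMeasure (F.P J) 0 (Matrix.specialUnitaryGroup (Fin 2) ℂ)) (heightDensity F (γ / lam) hJK (histGood F ℰp (θBal F.L γ b₀ p₀) K J)) V) + (F.scheme ℰp (γ / lam)).β K * minActionRegPr F J K hJK ε₀ V))
                - ((Real.log (Node00.canonVersion (fieldMeasure (F.P J) 0 (Matrix.specialUnitaryGroup (Fin 2) ℂ)) (heightDensity F (γ / lam) hJK (histGood F ℰp (θBal F.L γ b₀ p₀) K J)) W) + (F.scheme ℰp (γ / lam)).β K * minActionRegPr F J K hJK ε₀ W)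
                  - (Real.log (Node00.canonVersion (fieldMeasure (F.P J) 0 (Matrix.specialUnitaryGroup (Fin 2) ℂ)) (heightDensity F (γ / lam) hJK (histGood F ℰp (θBal F.L γ b₀ p₀) K J)) Z) + (F.scheme ℰp (γ / lam)).β K * minActionRegPr F J K hJK ε₀ Z)))|
              ≤ φ₂ J * Real.exp (-(κ * (b.src.tdist b'.src : ℝ))) :=
  beyondOneLoopSmallInt_of_repInt hS (repInt_of_multiGasInt hM)

end Doors

end Summit.QuantumFields.YangMills.Theorems.BeyondOneLoopInteriorMultiGasDoor

end
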